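import Summits.QuantumFields.YangMills.Theorems.ConvexGribovBodyNonSimplyConnectedLatticeGapWeakMixingFunnel
import HarnessLib

/-!
# The per-observable cube-influence constant is uniform on each box algebra (Banach–Steinhaus)
# (stub `stub_boxInfluence_uniform` (BS) of crux stmt-QuantumFields-16405, route `ConvexGribovBody`,
# line `Sketch` v6)

For the lattice Yang–Mills specification `γ = ymSpecification ρ β` on `ℤ⁴` (compact metrisable `G`, continuous `ρ`):
if EVERY gauge-invariant local observable `A` has its own constant `C_A` with
`|γ_{Λ_L}(A | η) − γ_{Λ_L}(A | η')| ≤ C_A e^{−mL}` on the cubes of links `Λ_L = [−L, L]⁴ × univ`, then for every `R`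
ONE constant `C_R` serves all gauge-invariant local `A` supported in the box `B_R = [−R, R]⁴ × univ` with `|A| ≤ 1`.

Proof (uniform boundedness principle). The bounded measurable gauge-invariant `B_R`-cylinder functions form a closed
subspace `E` of the Banach space `ℓ^∞(LGConfig 4 G, ℝ)` (sup-norm limits are pointwise limits, which preserve
measurability, the cylinder property and gauge invariance), hence a Banach space. The functionals
`A ↦ e^{mL} (γ_{Λ_L}(A | η) − γ_{Λ_L}(A | η'))`, indexed by `(L, η, η')`, are continuous linear (`‖·‖ ≤ 2 e^{mL}`) and
pointwise bounded by hypothesis, so `banach_steinhaus` bounds their operator norms uniformly.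

Structure: `stub_boxInfluence_uniform_ubp` is the abstract principle for a pointwise-sequentially-closed linear
class `P` of bounded real functions and abstract functionals; `stub_boxInfluence_uniform_integral` specialises the
functionals to weighted differences of integrals against two families of probability measures;
`stub_boxInfluence_uniform` is the registered signature.
-/

set_option autoImplicit false

noncomputable section

open MeasureTheory Filter Topology
open Literature.Probability.LatticeModels
open Literature.MathematicalPhysics.QuantumLattice
open Literature.MathematicalPhysics.QuantumFieldTheory (isSpecification_ymSpecification_of_t2Space)

namespace Summit.QuantumFields.YangMills.Theorems.NonSimplyConnectedLatticeGap

/-- **Uniform boundedness on a closed linear class of bounded functions** (abstract Banach–Steinhaus step).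
Let `P` be a class of real functions on `X` containing `0`, stable under sums, scalar multiples and pointwise
limits of sequences, and let `φ i` (`i : ι`) be functionals which are additive and homogeneous on bounded members
of `P` and satisfy `|φ i f| ≤ K i · M` whenever `|f| ≤ M`. If each bounded `f ∈ P` has `sup_i |φ i f| < ∞`, then
`|φ i f| ≤ C` for ONE `C`, all `i` and all `f ∈ P` with `|f| ≤ 1`. (The members of `P` inside `ℓ^∞(X, ℝ)` form a
closed, hence complete, subspace, on which the `φ i` are continuous linear functionals; `banach_steinhaus`.) -/
theorem stub_boxInfluence_uniform_ubp {X ι : Type*} (P : (X → ℝ) → Prop)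
    (hP0 : P 0) (hPadd : ∀ f g, P f → P g → P (f + g)) (hPsmul : ∀ (c : ℝ) (f : X → ℝ), P f → P (c • f))
    (hPlim : ∀ (F : ℕ → X → ℝ) (f : X → ℝ), (∀ n, P (F n)) →
      (∀ x, Tendsto (fun n => F n x) atTop (𝓝 (f x))) → P f)
    (φ : ι → (X → ℝ) → ℝ) (K : ι → ℝ)
    (hφadd : ∀ i f g, P f → P g → (∃ M, ∀ x, |f x| ≤ M) → (∃ M, ∀ x, |g x| ≤ M) →
      φ i (f + g) = φ i f + φ i g)
    (hφsmul : ∀ i (c : ℝ) f, P f → (∃ M, ∀ x, |f x| ≤ M) → φ i (c • f) = c * φ i f)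
    (hφbd : ∀ i f (M : ℝ), P f → 0 ≤ M → (∀ x, |f x| ≤ M) → |φ i f| ≤ K i * M)
    (hpt : ∀ f, P f → (∃ M, ∀ x, |f x| ≤ M) → ∃ C, ∀ i, |φ i f| ≤ C) :
    ∃ C, ∀ f, P f → (∀ x, |f x| ≤ 1) → ∀ i, |φ i f| ≤ C := by
  -- every element of `ℓ^∞(X, ℝ)` is bounded by its norm
  have hbdd : ∀ (f : lp (fun _ : X => ℝ) ⊤) (x : X), |f x| ≤ ‖f‖ := fun f x =>
    lp.norm_apply_le_norm ENNReal.top_ne_zero f x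
  have hex : ∀ f : lp (fun _ : X => ℝ) ⊤, ∃ M, ∀ x, |f x| ≤ M := fun f => ⟨‖f‖, hbdd f⟩
  -- the subspace `E` of `ℓ^∞(X, ℝ)` cut out by `P`
  obtain ⟨E, hE⟩ : ∃ E : Submodule ℝ (lp (fun _ : X => ℝ) ⊤), ∀ f, f ∈ E ↔ P ⇑f :=
    ⟨{ carrier := {f | P ⇑f}
       add_mem' := fun {f g} hf hg => hPadd (⇑f) (⇑g) hf hg
       zero_mem' := hP0
       smul_mem' := fun c f hf => hPsmul c (⇑f) hf }, fun _ => Iff.rfl⟩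
  -- `E` is closed (sup-norm limits are pointwise limits), hence complete
  have hclosed : IsClosed (E : Set (lp (fun _ : X => ℝ) ⊤)) := by
    refine IsSeqClosed.isClosed fun F f hF hlim => ?_
    have hpt' : ∀ x, Tendsto (fun n => F n x) atTop (𝓝 (f x)) := fun x =>
      tendsto_pi_nhds.1
        (((lp.uniformContinuous_coe (E := fun _ : X => ℝ) (p := ⊤)).continuous.tendsto f).comp hlim) x
    exact (hE f).2 (hPlim (fun n => ⇑(F n)) (⇑f) (fun n => (hE (F n)).1 (hF n)) hpt')
  haveI : CompleteSpace E := hclosed.completeSpace_coe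
  -- the functionals `φ i` as continuous linear maps on `E`
  obtain ⟨g, hg⟩ : ∃ g : ι → E →L[ℝ] ℝ, ∀ i (f : E), g i f = φ i ⇑(f : lp (fun _ : X => ℝ) ⊤) := by
    refine ⟨fun i => LinearMap.mkContinuous
      { toFun := fun f => φ i ⇑(f : lp (fun _ : X => ℝ) ⊤)
        map_add' := fun f f' => ?_
        map_smul' := fun c f => ?_ } (K i) (fun f => ?_), fun i f => rfl⟩
    · exact hφadd i (⇑(f : lp (fun _ : X => ℝ) ⊤)) (⇑(f' : lp (fun _ : X => ℝ) ⊤))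
        ((hE _).1 f.2) ((hE _).1 f'.2) (hex _) (hex _)
    · have h := hφsmul i c (⇑(f : lp (fun _ : X => ℝ) ⊤)) ((hE _).1 f.2) (hex _)
      simp only [RingHom.id_apply, smul_eq_mul]
      exact h
    · have h := hφbd i (⇑(f : lp (fun _ : X => ℝ) ⊤)) ‖(f : lp (fun _ : X => ℝ) ⊤)‖ ((hE _).1 f.2)
        (norm_nonneg _) (hbdd _)
      exact h
  -- Banach–Steinhaus: pointwise boundedness gives a uniform bound on the operator norms
  obtain ⟨C', hC'⟩ := banach_steinhaus (g := g) fun f => by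
    obtain ⟨C, hC⟩ := hpt (⇑(f : lp (fun _ : X => ℝ) ⊤)) ((hE _).1 f.2) (hex _)
    exact ⟨C, fun i => by rw [hg]; exact hC i⟩
  refine ⟨C', fun f hf h1 i => ?_⟩
  -- `f` is an element of `E` of norm at most `1`
  have hmem : Memℓp (fun x : X => f x) ⊤ :=
    memℓp_infty ⟨1, by rintro _ ⟨x, rfl⟩; exact (Real.norm_eq_abs _).trans_le (h1 x)⟩
  have hfE : (⟨fun x : X => f x, hmem⟩ : lp (fun _ : X => ℝ) ⊤) ∈ E := (hE _).2 hf
  have hnorm : ‖(⟨fun x : X => f x, hmem⟩ : lp (fun _ : X => ℝ) ⊤)‖ ≤ 1 :=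
    lp.norm_le_of_forall_le zero_le_one fun x => (Real.norm_eq_abs _).trans_le (h1 x)
  have hle := (g i).le_opNorm ⟨⟨fun x : X => f x, hmem⟩, hfE⟩
  rw [hg] at hle
  calc |φ i f| ≤ ‖g i‖ * ‖(⟨⟨fun x : X => f x, hmem⟩, hfE⟩ : E)‖ := hle
    _ ≤ ‖g i‖ * 1 := mul_le_mul_of_nonneg_left hnorm (ContinuousLinearMap.opNorm_nonneg (g i))
    _ ≤ C' := by rw [mul_one]; exact hC' i

/-- **Uniform boundedness for weighted differences of expectations.** On a measurable space `X`, let `P` be a class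
of measurable real functions containing `0`, stable under sums, scalar multiples and pointwise sequential limits;
let `μ i, ν i` be probability measures and `w i > 0` weights with `w i · w' i = 1`. If every bounded `f ∈ P` has a
constant `C_f` with `|∫ f dμ_i − ∫ f dν_i| ≤ C_f · w' i` for all `i`, then one constant serves all `f ∈ P` with
`|f| ≤ 1` (Banach–Steinhaus, `stub_boxInfluence_uniform_ubp`, for the functionals `f ↦ w i (∫ f dμ_i − ∫ f dν_i)`). -/
theorem stub_boxInfluence_uniform_integral {X : Type*} [MeasurableSpace X] {ι : Type*}
    (P : (X → ℝ) → Prop) (hPm : ∀ f, P f → Measurable f)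
    (hP0 : P 0) (hPadd : ∀ f g, P f → P g → P (f + g)) (hPsmul : ∀ (c : ℝ) (f : X → ℝ), P f → P (c • f))
    (hPlim : ∀ (F : ℕ → X → ℝ) (f : X → ℝ), (∀ n, P (F n)) →
      (∀ x, Tendsto (fun n => F n x) atTop (𝓝 (f x))) → P f)
    (μ ν : ι → Measure X) [∀ i, IsProbabilityMeasure (μ i)] [∀ i, IsProbabilityMeasure (ν i)]
    (w w' : ι → ℝ) (hw0 : ∀ i, 0 < w i) (hww' : ∀ i, w i * w' i = 1)
    (hpt : ∀ f, P f → (∃ M, ∀ x, |f x| ≤ M) →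
      ∃ C, ∀ i, |(∫ x, f x ∂μ i) - ∫ x, f x ∂ν i| ≤ C * w' i) :
    ∃ C, ∀ f, P f → (∀ x, |f x| ≤ 1) → ∀ i, |(∫ x, f x ∂μ i) - ∫ x, f x ∂ν i| ≤ C * w' i := by
  -- bounded members of `P` are integrable, with `|∫ f| ≤ M`
  have hint : ∀ f : X → ℝ, P f → (∃ M, ∀ x, |f x| ≤ M) → ∀ (m : Measure X) [IsProbabilityMeasure m],
      Integrable f m := by
    rintro f hf ⟨M, hM⟩ m _
    exact Integrable.of_bound (hPm f hf).aestronglyMeasurable M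
      (ae_of_all _ fun x => (Real.norm_eq_abs _).trans_le (hM x))
  have hle : ∀ (f : X → ℝ) (M : ℝ), (∀ x, |f x| ≤ M) → ∀ (m : Measure X) [IsProbabilityMeasure m],
      |∫ x, f x ∂m| ≤ M := by
    intro f M hM m _
    have h := norm_integral_le_of_norm_le_const (μ := m) (f := f) (C := M)
      (ae_of_all _ fun x => (Real.norm_eq_abs _).trans_le (hM x))
    rwa [probReal_univ, mul_one] at h
  have hw'0 : ∀ i, 0 < w' i := fun i =>
    (pos_iff_pos_of_mul_pos (show 0 < w i * w' i by rw [hww' i]; exact one_pos)).1 (hw0 i)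
  -- the functionals `f ↦ w i (∫ f dμ_i − ∫ f dν_i)` are additive, homogeneous and bounded by `2 w i ‖f‖∞`
  have hadd : ∀ (i : ι) (f g : X → ℝ), P f → P g → (∃ M, ∀ x, |f x| ≤ M) → (∃ M, ∀ x, |g x| ≤ M) →
      w i * ((∫ x, (f + g) x ∂μ i) - ∫ x, (f + g) x ∂ν i) =
        w i * ((∫ x, f x ∂μ i) - ∫ x, f x ∂ν i) + w i * ((∫ x, g x ∂μ i) - ∫ x, g x ∂ν i) := by
    intro i f g hf hg hfb hgb
    simp only [Pi.add_apply]
    rw [integral_add (hint f hf hfb _) (hint g hg hgb _), integral_add (hint f hf hfb _) (hint g hg hgb _)]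
    ring
  have hsmul : ∀ (i : ι) (c : ℝ) (f : X → ℝ), P f → (∃ M, ∀ x, |f x| ≤ M) →
      w i * ((∫ x, (c • f) x ∂μ i) - ∫ x, (c • f) x ∂ν i) =
        c * (w i * ((∫ x, f x ∂μ i) - ∫ x, f x ∂ν i)) := by
    intro i c f _ _
    simp only [Pi.smul_apply, smul_eq_mul]
    rw [integral_const_mul, integral_const_mul]
    ring
  have hbd : ∀ (i : ι) (f : X → ℝ) (M : ℝ), P f → 0 ≤ M → (∀ x, |f x| ≤ M) →
      |w i * ((∫ x, f x ∂μ i) - ∫ x, f x ∂ν i)| ≤ 2 * w i * M := by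
    intro i f M _ _ hM
    rw [abs_mul, abs_of_pos (hw0 i)]
    have h1 := hle f M hM (μ i)
    have h2 := hle f M hM (ν i)
    have h3 : |(∫ x, f x ∂μ i) - ∫ x, f x ∂ν i| ≤ 2 * M :=
      (abs_sub _ _).trans (by linarith)
    calc w i * |(∫ x, f x ∂μ i) - ∫ x, f x ∂ν i| ≤ w i * (2 * M) :=
          mul_le_mul_of_nonneg_left h3 (hw0 i).le
      _ = 2 * w i * M := by ring
  have hpt' : ∀ f : X → ℝ, P f → (∃ M, ∀ x, |f x| ≤ M) →
      ∃ C, ∀ i, |w i * ((∫ x, f x ∂μ i) - ∫ x, f x ∂ν i)| ≤ C := by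
    intro f hf hfb
    obtain ⟨C, hC⟩ := hpt f hf hfb
    refine ⟨C, fun i => ?_⟩
    rw [abs_mul, abs_of_pos (hw0 i)]
    calc w i * |(∫ x, f x ∂μ i) - ∫ x, f x ∂ν i| ≤ w i * (C * w' i) :=
          mul_le_mul_of_nonneg_left (hC i) (hw0 i).le
      _ = C := by rw [mul_left_comm, hww' i, mul_one]
  obtain ⟨C, hC⟩ := stub_boxInfluence_uniform_ubp P hP0 hPadd hPsmul hPlim
    (fun i f => w i * ((∫ x, f x ∂μ i) - ∫ x, f x ∂ν i)) (fun i => 2 * w i) hadd hsmul hbd hpt'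
  refine ⟨C, fun f hf h1 i => ?_⟩
  have h := hC f hf h1 i
  rw [abs_mul, abs_of_pos (hw0 i)] at h
  calc |(∫ x, f x ∂μ i) - ∫ x, f x ∂ν i| = w' i * (w i * |(∫ x, f x ∂μ i) - ∫ x, f x ∂ν i|) := by
        rw [← mul_assoc, mul_comm (w' i), hww' i, one_mul]
    _ ≤ w' i * C := mul_le_mul_of_nonneg_left h (hw'0 i).le
    _ = C * w' i := mul_comm _ _

/-- **The per-observable constant is uniform on each box algebra** (registered stub `stub_boxInfluence_uniform`
(BS) of the skeleton `Cruxes/NonSimplyConnectedLatticeGap/Lines/Sketch.lean` v6 of item stmt-QuantumFields-16405;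
Banach–Steinhaus): if every gauge-invariant local `A` has its own constant `C_A` in the cube-influence bound of
`ymSpecification ρ β` at rate `m`, then for every `R` one constant `C_R` serves all gauge-invariant local `A` with
`supp A ⊆ [−R, R]⁴ × univ` and `|A| ≤ 1`. The class of measurable gauge-invariant `[−R, R]⁴ × univ`-cylinder
functions is linear and closed under pointwise sequential limits (`measurable_of_tendsto_metrizable`, uniqueness of
limits), and `stub_boxInfluence_uniform_integral` applies with the weights `e^{mL}`, `e^{−mL}` and the probability
kernels `γ_{Λ_L}(· | η)`, `γ_{Λ_L}(· | η')` (`isSpecification_ymSpecification_of_t2Space`). -/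
theorem stub_boxInfluence_uniform : ∀ (G : Type) [Group G] [TopologicalSpace G] [IsTopologicalGroup G] [CompactSpace G] [MeasurableSpace G] [BorelSpace G] [SecondCountableTopology G] [T2Space G] (N : ℕ) (ρ : G →* Matrix (Fin N) (Fin N) ℂ), Continuous ρ → ∀ (β m : ℝ), (∀ A : Literature.MathematicalPhysics.QuantumLattice.LocalGaugeObservable 4 G, ∃ C : ℝ, ∀ (L : ℕ) (η η' : Literature.MathematicalPhysics.QuantumLattice.LGConfig 4 G), |(∫ U, A.F U ∂(Literature.MathematicalPhysics.QuantumLattice.ymSpecification ρ β ((Fintype.piFinset fun _ : Fin 4 => Finset.Icc (-((L : ℕ) : ℤ)) ((L : ℕ) : ℤ)) ×ˢ (Finset.univ : Finset (Fin 4))) η)) - ∫ U, A.F U ∂(Literature.MathematicalPhysics.QuantumLattice.ymSpecification ρ β ((Fintype.piFinset fun _ : Fin 4 => Finset.Icc (-((L : ℕ) : ℤ)) ((L : ℕ) : ℤ)) ×ˢ (Finset.univ : Finset (Fin 4))) η')| ≤ C * Real.exp (-(m * L))) → ∀ R : ℕ, ∃ C : ℝ, ∀ A : Literature.MathematicalPhysics.QuantumLattice.LocalGaugeObservable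 4 G, A.supp ⊆ (Fintype.piFinset fun _ : Fin 4 => Finset.Icc (-((R : ℕ) : ℤ)) ((R : ℕ) : ℤ)) ×ˢ (Finset.univ : Finset (Fin 4)) → (∀ U, |A.F U| ≤ 1) → ∀ (L : ℕ) (η η' : Literature.MathematicalPhysics.QuantumLattice.LGConfig 4 G), |(∫ U, A.F U ∂(Literature.MathematicalPhysics.QuantumLattice.ymSpecification ρ β ((Fintype.piFinset fun _ : Fin 4 => Finset.Icc (-((L : ℕ) : ℤ)) ((L : ℕ) : ℤ)) ×ˢ (Finset.univ : Finset (Fin 4))) η)) - ∫ U, A.F U ∂(Literature.MathematicalPhysics.QuantumLattice.ymSpecification ρ β ((Fintype.piFinset fun _ : Fin 4 => Finset.Icc (-((L : ℕ) : ℤ)) ((L : ℕ) : ℤ)) ×ˢ (Finset.univ : Finset (Fin 4))) η')| ≤ C * Real.exp (-(m * L)) := by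
  intro G _ _ _ _ _ _ _ _ N ρ hρ β m hA R
  -- the box of links `B = [−R, R]⁴ × univ` and the cubes `Λ L = [−L, L]⁴ × univ`
  obtain ⟨B, hB⟩ : ∃ B : Finset (ZdEdge 4), B = (Fintype.piFinset fun _ : Fin 4 =>
      Finset.Icc (-((R : ℕ) : ℤ)) ((R : ℕ) : ℤ)) ×ˢ (Finset.univ : Finset (Fin 4)) := ⟨_, rfl⟩
  obtain ⟨Λ, hΛ⟩ : ∃ Λ : ℕ → Finset (ZdEdge 4), Λ = fun L => (Fintype.piFinset fun _ : Fin 4 =>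
      Finset.Icc (-((L : ℕ) : ℤ)) ((L : ℕ) : ℤ)) ×ˢ (Finset.univ : Finset (Fin 4)) := ⟨_, rfl⟩
  -- the kernels are probability measures
  have hγ := isSpecification_ymSpecification_of_t2Space (d := 4) ρ hρ β
  haveI : ∀ i : ℕ × LGConfig 4 G × LGConfig 4 G,
      IsProbabilityMeasure (ymSpecification ρ β (Λ i.1) i.2.1) := fun i => hγ.isProbability _ _
  haveI : ∀ i : ℕ × LGConfig 4 G × LGConfig 4 G,
      IsProbabilityMeasure (ymSpecification ρ β (Λ i.1) i.2.2) := fun i => hγ.isProbability _ _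
  -- pointwise boundedness: the hypothesis applied to the local observable `⟨f, B, …⟩`
  have hpt : ∀ f : LGConfig 4 G → ℝ, (Measurable f ∧ DependsOn f (↑B : Set (ZdEdge 4)) ∧ IsZdGaugeInvariant f) →
      (∃ M, ∀ x, |f x| ≤ M) → ∃ C, ∀ i : ℕ × LGConfig 4 G × LGConfig 4 G,
        |(∫ x, f x ∂(ymSpecification ρ β (Λ i.1) i.2.1)) - ∫ x, f x ∂(ymSpecification ρ β (Λ i.1) i.2.2)| ≤
          C * Real.exp (-(m * (i.1 : ℝ))) := by
    rintro f ⟨hfm, hdep, hgi⟩ ⟨M, hM⟩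
    obtain ⟨C, hC⟩ := hA ⟨f, B, hdep, hgi, ⟨M, hM⟩, hfm⟩
    refine ⟨C, fun i => ?_⟩
    have h := hC i.1 i.2.1 i.2.2
    rw [hΛ]
    exact h
  -- Banach–Steinhaus on the class of measurable gauge-invariant `B`-cylinder functions
  obtain ⟨C, hC⟩ := stub_boxInfluence_uniform_integral
    (fun f : LGConfig 4 G → ℝ => Measurable f ∧ DependsOn f (↑B : Set (ZdEdge 4)) ∧ IsZdGaugeInvariant f)
    (fun f hf => hf.1)
    ⟨measurable_const, fun _ _ _ => rfl, fun _ _ => rfl⟩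
    (fun f g hf hg => ⟨hf.1.add hg.1,
      fun x y hxy => by rw [Pi.add_apply, Pi.add_apply, hf.2.1 hxy, hg.2.1 hxy],
      fun g' U => by rw [Pi.add_apply, Pi.add_apply, hf.2.2 g' U, hg.2.2 g' U]⟩)
    (fun c f hf => ⟨hf.1.const_smul c,
      fun x y hxy => by rw [Pi.smul_apply, Pi.smul_apply, hf.2.1 hxy],
      fun g' U => by rw [Pi.smul_apply, Pi.smul_apply, hf.2.2 g' U]⟩)
    (fun F f hF hlim => ⟨measurable_of_tendsto_metrizable (fun n => (hF n).1) (tendsto_pi_nhds.2 hlim),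
      fun x y hxy => tendsto_nhds_unique (hlim x)
        ((hlim y).congr fun n => ((hF n).2.1 hxy).symm),
      fun g' U => tendsto_nhds_unique (hlim (gaugeTransformZd g' U))
        ((hlim U).congr fun n => ((hF n).2.2 g' U).symm)⟩)
    (fun i : ℕ × LGConfig 4 G × LGConfig 4 G => ymSpecification ρ β (Λ i.1) i.2.1)
    (fun i : ℕ × LGConfig 4 G × LGConfig 4 G => ymSpecification ρ β (Λ i.1) i.2.2)
    (fun i => Real.exp (m * (i.1 : ℝ))) (fun i => Real.exp (-(m * (i.1 : ℝ))))
    (fun i => Real.exp_pos _) (fun i => by rw [← Real.exp_add, add_neg_cancel, Real.exp_zero]) hpt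
  -- the uniform constant
  refine ⟨C, fun A hsupp h1 L η η' => ?_⟩
  have hP : Measurable A.F ∧ DependsOn A.F (↑B : Set (ZdEdge 4)) ∧ IsZdGaugeInvariant A.F :=
    ⟨A.measurable, DependsOn.mono (by rw [hB]; exact Finset.coe_subset.2 hsupp) A.isCylinder,
      A.gaugeInvariant⟩
  have h := hC A.F hP h1 (L, η, η')
  rw [hΛ] at h
  exact h

end Summit.QuantumFields.YangMills.Theorems.NonSimplyConnectedLatticeGap

end
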